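import Mathlib
import Literature.Barriers.ValiantsHypothesis.AlgebraicNaturalProofs
import Literature.Computability.AlgebraicComplexity.ArithCircuitProofs
import Literature.Computability.AlgebraicComplexity.IMMInVPProofs
import Summits.ValiantsHypothesis.ValiantsHypothesis.Theorems.BarrierLeverPartitionMinorsHitByVPTwoBlockTropical
import Summits.ValiantsHypothesis.ValiantsHypothesis.Theorems.BarrierLeverPartitionMinorsHitByVPThresholdDoor

/-!
# Route BarrierLever — item `PartitionMinorsHitByVP` (stmt-ValiantsHypothesis-19717):
# the GENERAL SPLIT DOOR — threshold cells certified by ARBITRARY small circuits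

Helper file (`--supports stmt-ValiantsHypothesis-19717`; cell valiant-natproofs, rung V4, 𝒟-side,
prover seat valiant-natproofs-prover gen 6). Definition-free. Closes NO item.

`…ThresholdDoor.partitionMinor_hit_of_thresholdSplit` (p441705) needs the two threshold cells to
be certified by PRODUCT STATES; tiny cells such as `U = {1001,1011,1101}`, `W = {0000,1000,1001}`
(every 2×2 sub-cell a switch with disjoint difference coordinates) have no such certificate although
they are trivially hit (kit j253844). Here the cells are certified by ARBITRARY polynomials
`f₁, f₂ ∈ SmallCircuits ℂ (h+h) b`: the row/column scaling of the tropical argument is realised by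
RESCALING THE VARIABLES of `f₁` (`x_a ↦ x₀^{2Lλ_a} x_a`, `y_c ↦ x₀^{2μ_c} y_c`, an `aeval` by
`C s_i * X i`, cost `≤ 2h` extra gates by `complexity_aeval_le`), so the witness
`C(x₀^K) · f₁(s • x) + C(x₀^{c₀}) · f₂` lies in `SmallCircuits ℂ (h+h) (b+1)` (`h ≥ 2`).

* **`partitionMinor_hit_of_split`** — bijections `e : S ≃ T`, `e' : Sᶜ ≃ Tᶜ` of the threshold
  cells, `f₁` nonsingular on `(S,T)`, `f₂` nonsingular on `(Sᶜ,Tᶜ)`, both in `SmallCircuits ℂ (h+h) b`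
  ⇒ some `f ∈ SmallCircuits ℂ (h+h) (b+1)` is nonsingular on `(U,W)`. Consequently threshold
  HIERARCHIES compose additively: depth `D` from leaves in `SmallCircuits ℂ (h+h) b` gives
  `SmallCircuits ℂ (h+h) (b+D)`; leaves may be small cells (`…partitionMinor_hit_of_card_le`),
  automorphic cells, product-state cells, … .
WHAT THIS IS NOT: which layouts admit bounded-depth hierarchies is OPEN; nothing on crux 14610.
-/

set_option linter.dupNamespace false

namespace Summit.ValiantsHypothesis.ValiantsHypothesis.Theorems.BarrierLever.SplitDoor

open Finset
open Literature.Barriers.ValiantsHypothesis Literature.Computability.AlgebraicComplexity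
open Summit.ValiantsHypothesis.ValiantsHypothesis.Theorems.BarrierLever.TwoBlock
  (det_ne_zero_of_twoBlock det_fromBlocks_of_split_ne_zero)
open Summit.ValiantsHypothesis.ValiantsHypothesis.Theorems.BarrierLever.ThresholdDoor
  (prod_ite_zpow ite_le_ite_of_sign)


section Rescale

variable {n : ℕ}

/-- Coefficients of the rescaled polynomial `Σ_{m ∈ supp f} monomial m (coeff m f · ∏ s_i^{m_i})`. -/
theorem coeff_rescale (s : Fin n → ℂ) (f : MvPolynomial (Fin n) ℂ) (m : Fin n →₀ ℕ) :
    MvPolynomial.coeff m (∑ d ∈ f.support, MvPolynomial.monomial d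
      (MvPolynomial.coeff d f * ∏ i ∈ d.support, s i ^ d i)) =
      MvPolynomial.coeff m f * ∏ i ∈ m.support, s i ^ m i := by
  classical
  rw [MvPolynomial.coeff_sum]
  simp_rw [MvPolynomial.coeff_monomial]
  by_cases hm : m ∈ f.support
  · rw [Finset.sum_eq_single m (fun d _ hd => if_neg hd) (fun h' => absurd hm h'), if_pos rfl]
  · rw [Finset.sum_eq_zero, MvPolynomial.notMem_support_iff.mp hm, zero_mul]
    intro d hd
    rw [if_neg]
    rintro rfl
    exact hm hd

/-- The rescaled polynomial is the substitution `x_i ↦ s_i · x_i`. -/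
theorem rescale_eq_aeval (s : Fin n → ℂ) (f : MvPolynomial (Fin n) ℂ) :
    (∑ d ∈ f.support, MvPolynomial.monomial d
      (MvPolynomial.coeff d f * ∏ i ∈ d.support, s i ^ d i)) =
      MvPolynomial.aeval (fun i => MvPolynomial.C (s i) * MvPolynomial.X i) f := by
  classical
  conv_rhs => rw [f.as_sum]
  rw [map_sum]
  refine Finset.sum_congr rfl fun d _ => ?_
  rw [MvPolynomial.aeval_eq_bind₁, MvPolynomial.bind₁_monomial]
  simp_rw [mul_pow, ← map_pow]
  rw [Finset.prod_mul_distrib, ← map_prod, ← mul_assoc, ← map_mul, MvPolynomial.monomial_eq,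
    Finsupp.prod]

/-- Rescaling does not raise the total degree. -/
theorem totalDegree_rescale_le (s : Fin n → ℂ) (f : MvPolynomial (Fin n) ℂ) :
    (∑ d ∈ f.support, MvPolynomial.monomial d
      (MvPolynomial.coeff d f * ∏ i ∈ d.support, s i ^ d i)).totalDegree ≤ f.totalDegree := by
  classical
  refine (MvPolynomial.totalDegree_finsetSum _ _).trans (Finset.sup_le fun d hd => ?_)
  exact (MvPolynomial.totalDegree_monomial_le _ _).trans (MvPolynomial.le_totalDegree hd)

/-- Rescaling costs at most `n` gates (variables and constants are free). -/
theorem complexity_rescale_le (s : Fin n → ℂ) (f : MvPolynomial (Fin n) ℂ) :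
    complexity (∑ d ∈ f.support, MvPolynomial.monomial d
      (MvPolynomial.coeff d f * ∏ i ∈ d.support, s i ^ d i)) ≤ complexity f + n := by
  rw [rescale_eq_aeval]
  refine (complexity_aeval_le _ _).trans ?_
  gcongr
  calc ∑ i : Fin n, complexity (MvPolynomial.C (s i) * MvPolynomial.X i : MvPolynomial (Fin n) ℂ)
      ≤ ∑ _i : Fin n, 1 := Finset.sum_le_sum fun i _ => by
          calc _ ≤ complexity (MvPolynomial.C (s i) : MvPolynomial (Fin n) ℂ) +
                complexity (MvPolynomial.X i : MvPolynomial (Fin n) ℂ) + 1 := complexity_mul_le_holds _ _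
            _ = 1 := by rw [complexity_C_holds, complexity_X_holds]
    _ = n := by simp

/-- The rescaling factor of the partition monomial `x^U y^W`. -/
theorem rescale_factor_partition {h : ℕ} (s : Fin (h + h) → ℂ) (U W : Finset (Fin h)) :
    (∏ i ∈ ((∑ a ∈ U, Finsupp.single (Fin.castAdd h a) 1 +
        ∑ c ∈ W, Finsupp.single (Fin.natAdd h c) 1 : Fin (h + h) →₀ ℕ)).support,
      s i ^ ((∑ a ∈ U, Finsupp.single (Fin.castAdd h a) 1 +
        ∑ c ∈ W, Finsupp.single (Fin.natAdd h c) 1 : Fin (h + h) →₀ ℕ) : Fin (h + h) → ℕ) i) =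
      (∏ a : Fin h, (if a ∈ U then s (Fin.castAdd h a) else 1)) *
        ∏ c : Fin h, (if c ∈ W then s (Fin.natAdd h c) else 1) := by
  classical
  set m : Fin (h + h) →₀ ℕ := ∑ a ∈ U, Finsupp.single (Fin.castAdd h a) 1 +
    ∑ c ∈ W, Finsupp.single (Fin.natAdd h c) 1 with hm
  have hfull : (∏ i ∈ m.support, s i ^ (m : Fin (h + h) → ℕ) i) = ∏ i, s i ^ (m : Fin (h + h) → ℕ) i := by
    apply Finset.prod_subset (Finset.subset_univ _)
    intro i _ hi
    rw [Finsupp.notMem_support_iff.mp hi, pow_zero]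
  rw [hfull, Fin.prod_univ_add]
  congr 1
  · refine Finset.prod_congr rfl fun a _ => ?_
    rw [hm, Summit.ValiantsHypothesis.ValiantsHypothesis.Theorems.BarrierLever.ProductStateSums.partitionExpo_apply_castAdd]
    by_cases ha : a ∈ U <;> simp [ha]
  · refine Finset.prod_congr rfl fun c _ => ?_
    rw [hm, Summit.ValiantsHypothesis.ValiantsHypothesis.Theorems.BarrierLever.ProductStateSums.partitionExpo_apply_natAdd]
    by_cases hc : c ∈ W <;> simp [hc]

end Rescale


/-- **General split door.** Threshold cells `S = {i : cu < Σ_{a∈u i} λ a}`, `T = {j : cw < Σ μ}`,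
bijections `e : S ≃ T`, `e' : Sᶜ ≃ Tᶜ`; if `f₁ ∈ SmallCircuits ℂ (h+h) b` is nonsingular on the cell
`(S,T)` and `f₂ ∈ SmallCircuits ℂ (h+h) b` on `(Sᶜ,Tᶜ)`, then some `f ∈ SmallCircuits ℂ (h+h) (b+1)`
is nonsingular on the whole layout (`h ≥ 2`, `b ≥ 1`). -/
theorem partitionMinor_hit_of_split (h r b₀ : ℕ) (hh : 2 ≤ h) (hb₀ : 1 ≤ b₀) (u w : Fin r → Finset (Fin h))
    (lam mu : Fin h → ℤ) (cu cw : ℤ)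
    (e : {i : Fin r // cu < ∑ a ∈ u i, lam a} ≃ {j : Fin r // cw < ∑ c ∈ w j, mu c})
    (e' : {i : Fin r // ¬ cu < ∑ a ∈ u i, lam a} ≃ {j : Fin r // ¬ cw < ∑ c ∈ w j, mu c})
    (f₁ f₂ : MvPolynomial (Fin (h + h)) ℂ)
    (hf₁ : f₁ ∈ SmallCircuits ℂ (h + h) b₀) (hf₂ : f₂ ∈ SmallCircuits ℂ (h + h) b₀)
    (hp : (Matrix.of fun i i' : {i : Fin r // cu < ∑ a ∈ u i, lam a} => MvPolynomial.coeff
        (∑ a ∈ u i.1, Finsupp.single (Fin.castAdd h a) 1 +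
          ∑ c ∈ w (e i').1, Finsupp.single (Fin.natAdd h c) 1) f₁).det ≠ 0)
    (hq : (Matrix.of fun i i' : {i : Fin r // ¬ cu < ∑ a ∈ u i, lam a} => MvPolynomial.coeff
        (∑ a ∈ u i.1, Finsupp.single (Fin.castAdd h a) 1 +
          ∑ c ∈ w (e' i').1, Finsupp.single (Fin.natAdd h c) 1) f₂).det ≠ 0) :
    ∃ f ∈ SmallCircuits ℂ (h + h) (b₀ + 1),
      (Matrix.of fun i j : Fin r => MvPolynomial.coeff
        (∑ a ∈ u i, Finsupp.single (Fin.castAdd h a) 1 +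
          ∑ c ∈ w j, Finsupp.single (Fin.natAdd h c) 1) f).det ≠ 0 := by
  classical
  set rowv : Fin r → ℤ := fun i => ∑ a ∈ u i, lam a with hrowv
  set colv : Fin r → ℤ := fun j => ∑ c ∈ w j, mu c with hcolv
  set a : Fin r → ℤ := fun i => 2 * (rowv i - cu) - 1 with ha
  set b : Fin r → ℤ := fun j => 2 * (colv j - cw) - 1 with hb
  have ha_pos : ∀ i, 0 < a i ↔ cu < rowv i := fun i => by simp only [ha]; omega
  have hb_pos : ∀ j, 0 < b j ↔ cw < colv j := fun j => by simp only [hb]; omega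
  have ha_ne : ∀ i, a i ≠ 0 := fun i => by simp only [ha]; omega
  have hb_ne : ∀ j, b j ≠ 0 := fun j => by simp only [hb]; omega
  set Mb : ℤ := ∑ j, |b j| with hMb
  set L : ℤ := Mb + 1 with hL
  have hMb0 : 0 ≤ Mb := Finset.sum_nonneg fun j _ => abs_nonneg (b j)
  have hbMb : ∀ j, |b j| ≤ Mb := fun j => by
    have := Finset.single_le_sum (f := fun j => |b j|) (fun j _ => abs_nonneg (b j))
      (Finset.mem_univ j)
    simpa using this
  have hsign : ∀ i j, (0 < L * a i + b j ↔ 0 < a i) ∧ L * a i + b j ≠ 0 := by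
    intro i j
    have h1 := hbMb j
    have h3 := le_abs_self (b j)
    have h4 := neg_abs_le (b j)
    rcases lt_or_gt_of_ne (ha_ne i) with hneg | hpos
    · have h5 : L * a i ≤ -L := by nlinarith
      exact ⟨⟨fun hh => by omega, fun hh => by omega⟩, by omega⟩
    · have h5 : L ≤ L * a i := by nlinarith
      exact ⟨⟨fun _ => hpos, fun _ => by omega⟩, by omega⟩
  set Ma : ℤ := ∑ i, |a i| with hMa
  have hMa0 : 0 ≤ Ma := Finset.sum_nonneg fun i _ => abs_nonneg (a i)
  have haMa : ∀ i, |a i| ≤ Ma := fun i => by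
    have := Finset.single_le_sum (f := fun i => |a i|) (fun i _ => abs_nonneg (a i))
      (Finset.mem_univ i)
    simpa using this
  set C0 : ℤ := L * Ma + Mb with hC0
  have hC0_nonneg : 0 ≤ C0 := by nlinarith
  have hd_nonneg : ∀ i j, 0 ≤ C0 + L * a i + b j := by
    intro i j
    have h1 := haMa i; have h2 := hbMb j
    have h3 := neg_abs_le (a i); have h4 := neg_abs_le (b j)
    nlinarith
  set d : Fin r → Fin r → ℕ := fun i j => (C0 + L * a i + b j).toNat with hd
  set c₀ : ℕ := C0.toNat with hc₀
  have hd_cast : ∀ i j, ((d i j : ℕ) : ℤ) = C0 + L * a i + b j := fun i j =>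
    Int.toNat_of_nonneg (hd_nonneg i j)
  have hc₀_cast : ((c₀ : ℕ) : ℤ) = C0 := Int.toNat_of_nonneg hC0_nonneg
  set S : Finset (Fin r) := Finset.univ.filter (fun i => cu < rowv i) with hS
  set T : Finset (Fin r) := Finset.univ.filter (fun j => cw < colv j) with hT
  have hmemS : ∀ i, i ∈ S ↔ cu < rowv i := fun i => by simp [hS]
  have hmemT : ∀ j, j ∈ T ↔ cw < colv j := fun j => by simp [hT]
  have hK1 : ∀ i j, d i j ≠ c₀ := by
    intro i j hh
    apply (hsign i j).2
    have := congrArg (fun n : ℕ => (n : ℤ)) hh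
    simp only [hd_cast, hc₀_cast] at this
    linarith
  have hK2 : ∀ i j, c₀ < d i j ↔ i ∈ S := by
    intro i j
    rw [hmemS, ← ha_pos, ← (hsign i j).1, ← Nat.cast_lt (α := ℤ), hd_cast, hc₀_cast]
    constructor <;> intro hh <;> linarith
  have htop : ∀ i j, ((max (d i j) c₀ : ℕ) : ℤ) = C0 + (if i ∈ S then L * a i + b j else 0) := by
    intro i j
    rw [Nat.cast_max, hd_cast, hc₀_cast]
    by_cases hi : i ∈ S
    · have := ((hsign i j).1).mpr ((ha_pos i).mpr ((hmemS i).mp hi))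
      rw [if_pos hi, max_eq_left (by linarith)]
      ring
    · have : ¬ 0 < L * a i + b j :=
        fun hh => hi ((hmemS i).mpr ((ha_pos i).mp (((hsign i j).1).mp hh)))
      rw [if_neg hi, add_zero, max_eq_right (by linarith)]
  have hsum : ∀ σ : Equiv.Perm (Fin r), ((∑ j, max (d (σ j) j) c₀ : ℕ) : ℤ) =
      r * C0 + L * (∑ i, if i ∈ S then a i else 0) + ∑ j, (if σ j ∈ S then b j else 0) := by
    intro σ
    rw [Nat.cast_sum]
    simp_rw [htop]
    rw [Finset.sum_add_distrib, Finset.sum_const, Finset.card_univ, Fintype.card_fin,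
      nsmul_eq_mul]
    have hsplit : ∀ j, (if σ j ∈ S then L * a (σ j) + b j else 0) =
        L * (if σ j ∈ S then a (σ j) else 0) + (if σ j ∈ S then b j else 0) := fun j => by
      by_cases hj : σ j ∈ S
      · rw [if_pos hj, if_pos hj, if_pos hj]
      · rw [if_neg hj, if_neg hj, if_neg hj, mul_zero, add_zero]
    simp_rw [hsplit]
    rw [Finset.sum_add_distrib, ← Finset.mul_sum,
      Fintype.sum_equiv σ (fun j => if σ j ∈ S then a (σ j) else 0)
        (fun i => if i ∈ S then a i else 0) (fun j => rfl)]
    ring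
  have hB_le : ∀ σ : Equiv.Perm (Fin r),
      (∑ j, (if σ j ∈ S then b j else 0)) ≤ ∑ j, (if j ∈ T then b j else 0) := fun σ =>
    Finset.sum_le_sum fun j _ =>
      (ite_le_ite_of_sign (b j) (hb_ne j) ((hb_pos j).trans (hmemT j).symm)).1
  have hB_eq : ∀ σ : Equiv.Perm (Fin r), (∀ j, σ j ∈ S ↔ j ∈ T) →
      (∑ j, (if σ j ∈ S then b j else 0)) = ∑ j, (if j ∈ T then b j else 0) := fun σ hσ =>
    Finset.sum_congr rfl fun j _ =>
      ((ite_le_ite_of_sign (b j) (hb_ne j) ((hb_pos j).trans (hmemT j).symm)).2).mpr (hσ j)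
  have hB_lt : ∀ σ : Equiv.Perm (Fin r), ¬ (∀ j, σ j ∈ S ↔ j ∈ T) →
      (∑ j, (if σ j ∈ S then b j else 0)) < ∑ j, (if j ∈ T then b j else 0) := fun σ hσ => by
    obtain ⟨j₀, hj₀⟩ := not_forall.mp hσ
    have key := ite_le_ite_of_sign (S := σ j₀ ∈ S) (b j₀) (hb_ne j₀)
      ((hb_pos j₀).trans (hmemT j₀).symm)
    exact Finset.sum_lt_sum (fun j _ =>
      (ite_le_ite_of_sign (b j) (hb_ne j) ((hb_pos j).trans (hmemT j).symm)).1)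
      ⟨j₀, Finset.mem_univ _, lt_of_le_of_ne key.1 (fun hh => hj₀ (key.2.mp hh))⟩
  set NZ : ℤ := r * C0 + L * (∑ i, if i ∈ S then a i else 0) + ∑ j, (if j ∈ T then b j else 0)
    with hNZ
  have hNZ_nonneg : 0 ≤ NZ := by
    have h0 : (0 : ℤ) ≤ ((∑ j, max (d ((1 : Equiv.Perm (Fin r)) j) j) c₀ : ℕ) : ℤ) :=
      Nat.cast_nonneg _
    rw [hsum 1] at h0
    have := hB_le 1
    linarith
  set N : ℕ := NZ.toNat with hN
  have hN_cast : ((N : ℕ) : ℤ) = NZ := Int.toNat_of_nonneg hNZ_nonneg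
  have htop_eq : ∀ σ : Equiv.Perm (Fin r), (∀ j, σ j ∈ S ↔ j ∈ T) →
      ∑ j, max (d (σ j) j) c₀ = N := fun σ hσ => by
    have h1 := hsum σ
    rw [hB_eq σ hσ] at h1
    exact_mod_cast h1.trans hN_cast.symm
  have htop_lt : ∀ σ : Equiv.Perm (Fin r), ¬ (∀ j, σ j ∈ S ↔ j ∈ T) →
      ∑ j, max (d (σ j) j) c₀ < N := fun σ hσ => by
    have h1 := hsum σ
    have h2 := hB_lt σ hσ
    have : ((∑ j, max (d (σ j) j) c₀ : ℕ) : ℤ) < (N : ℤ) := by rw [h1, hN_cast]; linarith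
    exact_mod_cast this
  set p : Matrix (Fin r) (Fin r) ℂ := Matrix.of fun i j => MvPolynomial.coeff
    (∑ a ∈ u i, Finsupp.single (Fin.castAdd h a) 1 + ∑ c ∈ w j, Finsupp.single (Fin.natAdd h c) 1) f₁
    with hpdef
  set q : Matrix (Fin r) (Fin r) ℂ := Matrix.of fun i j => MvPolynomial.coeff
    (∑ a ∈ u i, Finsupp.single (Fin.castAdd h a) 1 + ∑ c ∈ w j, Finsupp.single (Fin.natAdd h c) 1) f₂
    with hqdef
  let φS : {i : Fin r // cu < rowv i} ≃ {i // i ∈ S} :=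
    Equiv.subtypeEquivRight (fun i => (hmemS i).symm)
  let φT : {j : Fin r // cw < colv j} ≃ {j // j ∈ T} :=
    Equiv.subtypeEquivRight (fun j => (hmemT j).symm)
  let φS' : {i : Fin r // ¬ cu < rowv i} ≃ {i // i ∉ S} :=
    Equiv.subtypeEquivRight (fun i => by rw [hmemS])
  let φT' : {j : Fin r // ¬ cw < colv j} ≃ {j // j ∉ T} :=
    Equiv.subtypeEquivRight (fun j => by rw [hmemT])
  let eS : {i // i ∈ S} ≃ {j // j ∈ T} := φS.symm.trans (e.trans φT)
  let eS' : {i // i ∉ S} ≃ {j // j ∉ T} := φS'.symm.trans (e'.trans φT')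
  have hp' : (Matrix.of fun i i' : {i // i ∈ S} => p i (eS i')).det ≠ 0 := by
    have hre : (Matrix.of fun i i' : {i // i ∈ S} => p i (eS i')) =
        (Matrix.of fun i i' : {i : Fin r // cu < rowv i} => MvPolynomial.coeff
          (∑ a ∈ u i.1, Finsupp.single (Fin.castAdd h a) 1 +
            ∑ c ∈ w (e i').1, Finsupp.single (Fin.natAdd h c) 1) f₁).reindex φS φS := by
      ext i i'
      rfl
    rw [hre, Matrix.det_reindex_self]
    exact hp
  have hq' : (Matrix.of fun i i' : {i // i ∉ S} => q i (eS' i')).det ≠ 0 := by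
    have hre : (Matrix.of fun i i' : {i // i ∉ S} => q i (eS' i')) =
        (Matrix.of fun i i' : {i : Fin r // ¬ cu < rowv i} => MvPolynomial.coeff
          (∑ a ∈ u i.1, Finsupp.single (Fin.castAdd h a) 1 +
            ∑ c ∈ w (e' i').1, Finsupp.single (Fin.natAdd h c) 1) f₂).reindex φS' φS' := by
      ext i i'
      rfl
    rw [hre, Matrix.det_reindex_self]
    exact hq
  have hG := det_fromBlocks_of_split_ne_zero p q S T eS eS' hp' hq'
  have hA := det_ne_zero_of_twoBlock p q d c₀ S T hK1 hK2 N htop_eq htop_lt hG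
  set A : Matrix (Fin r) (Fin r) (Polynomial ℂ) := Matrix.of fun i j : Fin r =>
    Polynomial.C (p i j) * Polynomial.X ^ d i j + Polynomial.C (q i j) * Polynomial.X ^ c₀ with hAdef
  have hD : (Polynomial.X * A.det) ≠ 0 := mul_ne_zero Polynomial.X_ne_zero hA
  obtain ⟨x₀, hx₀⟩ := Infinite.exists_notMem_finset (Polynomial.X * A.det).roots.toFinset
  rw [Multiset.mem_toFinset, Polynomial.mem_roots hD, Polynomial.IsRoot.def, Polynomial.eval_mul,
    Polynomial.eval_X, mul_eq_zero, not_or] at hx₀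
  obtain ⟨hx₀ne, hdetx⟩ := hx₀
  have hevaldet : Polynomial.eval x₀ A.det =
      (Matrix.of fun i j : Fin r => p i j * x₀ ^ d i j + q i j * x₀ ^ c₀).det := by
    rw [← Polynomial.coe_evalRingHom, RingHom.map_det]
    congr 1
    ext i j
    simp [hAdef, RingHom.mapMatrix_apply, Matrix.map_apply]
  set K : ℤ := C0 - 2 * L * cu - L - 2 * cw - 1 with hK
  have hdZ : ∀ i j, ((d i j : ℕ) : ℤ) = K + (∑ a ∈ u i, 2 * L * lam a) + ∑ c ∈ w j, 2 * mu c := by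
    intro i j
    have h1 : (∑ a ∈ u i, 2 * L * lam a) = 2 * L * rowv i := by
      rw [hrowv, Finset.mul_sum]
    have h2 : (∑ c ∈ w j, 2 * mu c) = 2 * colv j := by
      rw [hcolv, Finset.mul_sum]
    rw [h1, h2, hd_cast, hK, ha, hb]
    ring
  set s : Fin (h + h) → ℂ := fun i => Fin.addCases (fun a => x₀ ^ (2 * L * lam a))
    (fun c => x₀ ^ (2 * mu c)) i with hs
  have hs_cast : ∀ a : Fin h, s (Fin.castAdd h a) = x₀ ^ (2 * L * lam a) := fun a =>
    Fin.addCases_left _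
  have hs_nat : ∀ c : Fin h, s (Fin.natAdd h c) = x₀ ^ (2 * mu c) := fun c =>
    Fin.addCases_right _
  set g₁ : MvPolynomial (Fin (h + h)) ℂ := ∑ dd ∈ f₁.support, MvPolynomial.monomial dd
      (MvPolynomial.coeff dd f₁ * ∏ i ∈ dd.support, s i ^ dd i) with hg₁
  set f : MvPolynomial (Fin (h + h)) ℂ := MvPolynomial.C (x₀ ^ K) * g₁ + MvPolynomial.C (x₀ ^ c₀) * f₂
    with hf
  refine ⟨f, ⟨?_, ?_⟩, ?_⟩
  · -- degree
    refine (MvPolynomial.totalDegree_add _ _).trans (max_le ?_ ?_)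
    · exact (MvPolynomial.totalDegree_mul _ _).trans (by
        rw [MvPolynomial.totalDegree_C, zero_add]
        exact (totalDegree_rescale_le s f₁).trans hf₁.1)
    · exact (MvPolynomial.totalDegree_mul _ _).trans (by
        rw [MvPolynomial.totalDegree_C, zero_add]; exact hf₂.1)
  · -- size
    calc complexity f ≤ complexity (MvPolynomial.C (x₀ ^ K) * g₁) +
          complexity (MvPolynomial.C (x₀ ^ c₀) * f₂) + 1 := complexity_add_le_holds _ _
      _ ≤ (0 + (complexity f₁ + (h + h)) + 1) + (0 + complexity f₂ + 1) + 1 := by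
          gcongr
          · refine (complexity_mul_le_holds _ _).trans ?_
            gcongr
            · exact (complexity_C_holds _).le
            · exact complexity_rescale_le s f₁
          · refine (complexity_mul_le_holds _ _).trans ?_
            gcongr
            exact (complexity_C_holds _).le
      _ ≤ (0 + ((h + h) ^ b₀ + (h + h)) + 1) + (0 + (h + h) ^ b₀ + 1) + 1 := by
          gcongr
          · exact hf₁.2
          · exact hf₂.2
      _ ≤ (h + h) ^ (b₀ + 1) := by
          have h4 : 4 ≤ h + h := by omega
          have hP : h + h ≤ (h + h) ^ b₀ := by
            calc h + h = (h + h) ^ 1 := (pow_one _).symm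
              _ ≤ (h + h) ^ b₀ := Nat.pow_le_pow_right (by omega) hb₀
          have ha' : 4 * (h + h) ^ b₀ ≤ (h + h) * (h + h) ^ b₀ := Nat.mul_le_mul_right _ h4
          have hb' : 4 * (h + h) ≤ (h + h) * (h + h) ^ b₀ := by
            calc 4 * (h + h) ≤ (h + h) * (h + h) := Nat.mul_le_mul_right _ h4
              _ ≤ (h + h) * (h + h) ^ b₀ := Nat.mul_le_mul_left _ hP
          have hc' : 16 ≤ (h + h) * (h + h) ^ b₀ := le_trans (by omega) hb'
          calc (0 + ((h + h) ^ b₀ + (h + h)) + 1) + (0 + (h + h) ^ b₀ + 1) + 1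
              ≤ (h + h) * (h + h) ^ b₀ := by linarith
            _ = (h + h) ^ (b₀ + 1) := by ring
  · -- the layout minor of f is the evaluated tropical matrix
    have hcoef : ∀ i j : Fin r, MvPolynomial.coeff
        (∑ a ∈ u i, Finsupp.single (Fin.castAdd h a) 1 + ∑ c ∈ w j, Finsupp.single (Fin.natAdd h c) 1)
        f = p i j * x₀ ^ d i j + q i j * x₀ ^ c₀ := by
      intro i j
      rw [hf, MvPolynomial.coeff_add, MvPolynomial.coeff_C_mul, MvPolynomial.coeff_C_mul, hg₁,
        coeff_rescale, rescale_factor_partition]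
      simp_rw [hs_cast, hs_nat]
      rw [prod_ite_zpow x₀ hx₀ne, prod_ite_zpow x₀ hx₀ne, hpdef, hqdef, Matrix.of_apply,
        Matrix.of_apply]
      have hpow : x₀ ^ K * (x₀ ^ (∑ a ∈ u i, 2 * L * lam a) * x₀ ^ (∑ c ∈ w j, 2 * mu c)) =
          x₀ ^ (d i j) := by
        rw [← zpow_natCast, hdZ, zpow_add₀ hx₀ne, zpow_add₀ hx₀ne]
        ring
      rw [← hpow]
      ring
    have hM : (Matrix.of fun i j : Fin r => MvPolynomial.coeff
        (∑ a ∈ u i, Finsupp.single (Fin.castAdd h a) 1 + ∑ c ∈ w j, Finsupp.single (Fin.natAdd h c) 1)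
        f) = Matrix.of fun i j : Fin r => p i j * x₀ ^ d i j + q i j * x₀ ^ c₀ := by
      ext i j
      rw [Matrix.of_apply, Matrix.of_apply, hcoef]
    rw [hM, ← hevaldet]
    exact hdetx

end Summit.ValiantsHypothesis.ValiantsHypothesis.Theorems.BarrierLever.SplitDoor
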